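import Summits.CriticalPhenomena.CardyFormulaZ2.Theorems.CardyBoundaryCoulombGasHalfPlaneMarkDensityLawWindowLowerBound

/-!
# `HalfPlaneMarkDensityLaw` (crux stmt-CriticalPhenomena-5661), line `Sketch`, cycle 4 (positivity):
# glue Q3' — Werner's counting for the nearest-left-neighbour statistic

Write `NL(k; lo, hi)` for the event that the nearest bottom point `t < k` of the `H`-cluster of `(k,0)`
(`H = ℤ×ℕ`) lies in `[lo, hi]`.  Given the deterministic inclusion Q1 (on the window event
`{L(B,c') ∈ [1,w]}` some `k ∈ [1,w]` satisfies `NL(k; lo, c'−1)`) and translation invariance Q2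
(`P[NL(k; lo+k, hi+k)] = P[NL(0; lo, hi)]`), the macroscopic window lower bound
`Window.stub_windowLowerBound` at the marks `a' < b' < c'' < 0 < y'`,
`y' = (b−a)/4`, `c'' = −(x−b) − (b−a)/4`, `b' = −(x−b) − (b−a)/2`, `a' = −(x−a) + 3(b−a)/8`,
gives for large `n`, with `k₀ = ⌊xn⌋`, `lo₀ = ⌊an⌋ − k₀`, `hi₀ = ⌊bn⌋ − k₀`, `w = ⌊y'n⌋`:
window event `⊆ ⋃_{k ∈ [1,w]} NL(k; lo₀+k, hi₀+k)` (Q1 and monotonicity of `NL` in the interval, the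
floor margins being `(b−a)/8` and `(b−a)/4`), so the union bound and Q2 give
`c₀ ≤ w · P[NL(0; lo₀, hi₀)] = w · P[NL(k₀; ⌊an⌋, ⌊bn⌋)] ≤ y' n · P[NL(k₀; ⌊an⌋, ⌊bn⌋)]`,
i.e. `n · P[NL(⌊xn⌋; ⌊an⌋, ⌊bn⌋)] ≥ c₀ / y'`.
-/

noncomputable section

namespace Summit.CriticalPhenomena.CardyFormulaZ2.Cruxes.HalfPlaneMarkDensityLaw.SketchLine

open Literature.Probability.Percolation Literature.Probability.LatticeModels
open MeasureTheory Filter Set SimpleGraph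
open scoped Topology
open Summit.CriticalPhenomena.CardyFormulaZ2.Theorems.HalfPlaneMarkDensityLaw.Negative

namespace Positivity

/-- Eventually-in-`n` four-floor arithmetic: `p + q < r + s` gives `⌊pn⌋ + ⌊qn⌋ + 2 ≤ ⌊rn⌋ + ⌊sn⌋`.
[folklore] -/
private theorem eventually_floor_add_floor_add_two_le {p q r s : ℝ} (h : p + q < r + s) :
    ∀ᶠ n : ℕ in atTop, ⌊p * n⌋ + ⌊q * n⌋ + 2 ≤ ⌊r * n⌋ + ⌊s * n⌋ := by
  have hpos : 0 < r + s - p - q := by linarith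
  have e1 : ∀ᶠ n : ℕ in atTop, (4 : ℝ) ≤ (r + s - p - q) * n :=
    (tendsto_natCast_atTop_atTop.const_mul_atTop hpos).eventually_ge_atTop _
  filter_upwards [e1] with n hn
  have h1 : ((⌊p * (n : ℝ)⌋ : ℤ) : ℝ) ≤ p * n := Int.floor_le _
  have h2 : ((⌊q * (n : ℝ)⌋ : ℤ) : ℝ) ≤ q * n := Int.floor_le _
  have h3 : (r * n : ℝ) < ⌊r * (n : ℝ)⌋ + 1 := Int.lt_floor_add_one _
  have h4 : (s * n : ℝ) < ⌊s * (n : ℝ)⌋ + 1 := Int.lt_floor_add_one _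
  have h5 : ((⌊p * (n : ℝ)⌋ + ⌊q * (n : ℝ)⌋ + 2 : ℤ) : ℝ) <
      ((⌊r * (n : ℝ)⌋ + ⌊s * (n : ℝ)⌋ + 1 : ℤ) : ℝ) := by
    push_cast; nlinarith
  have := Int.cast_lt.1 h5
  omega

/-- Abstract Werner counting (union bound over lattice translates): if every configuration of `W`
lies in some `N k lo (c'−1)` with `k ∈ [1,w]`, the events `N k · ·` are monotone in the interval,
and every translate `N k (lo₀+k) (hi₀+k)` has the probability of `N 0 lo₀ hi₀`, then
`P[W] ≤ w · P[N 0 lo₀ hi₀]` as soon as `lo₀ + w ≤ lo` and `c' − 1 ≤ hi₀ + 1`. [folklore] -/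
private theorem measureReal_le_mul_of_cover {Ω : Type*} [MeasurableSpace Ω] (P : Measure Ω)
    [IsFiniteMeasure P] (N : ℤ → ℤ → ℤ → Set Ω) (W : Set Ω) {lo c' w lo₀ hi₀ : ℤ}
    (hmono : ∀ k lo₁ hi₁ lo₂ hi₂ : ℤ, lo₂ ≤ lo₁ → hi₁ ≤ hi₂ → N k lo₁ hi₁ ⊆ N k lo₂ hi₂)
    (hcover : ∀ ω ∈ W, ∃ k : ℤ, 1 ≤ k ∧ k ≤ w ∧ ω ∈ N k lo (c' - 1))
    (hshift : ∀ k : ℤ, P.real (N k (lo₀ + k) (hi₀ + k)) = P.real (N 0 lo₀ hi₀))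
    (h1 : lo₀ + w ≤ lo) (h2 : c' - 1 ≤ hi₀ + 1) (hw : 0 ≤ w) :
    P.real W ≤ w * P.real (N 0 lo₀ hi₀) := by
  have hsub : W ⊆ ⋃ k ∈ Finset.Icc 1 w, N k (lo₀ + k) (hi₀ + k) := by
    intro ω hω
    obtain ⟨k, hk1, hkw, hkN⟩ := hcover ω hω
    exact Set.mem_iUnion₂.2 ⟨k, Finset.mem_Icc.2 ⟨hk1, hkw⟩,
      hmono k lo (c' - 1) (lo₀ + k) (hi₀ + k) (by omega) (by omega) hkN⟩
  have hcardZ : ((Finset.Icc (1 : ℤ) w).card : ℤ) = w := by simp [hw]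
  have hcard : (((Finset.Icc (1 : ℤ) w).card : ℤ) : ℝ) = (w : ℝ) := by exact_mod_cast hcardZ
  calc P.real W ≤ P.real (⋃ k ∈ Finset.Icc 1 w, N k (lo₀ + k) (hi₀ + k)) :=
        measureReal_mono hsub (measure_ne_top _ _)
    _ ≤ ∑ k ∈ Finset.Icc 1 w, P.real (N k (lo₀ + k) (hi₀ + k)) := measureReal_biUnion_finset_le _ _
    _ = ∑ k ∈ Finset.Icc 1 w, P.real (N 0 lo₀ hi₀) := Finset.sum_congr rfl fun k _ => hshift k
    _ = w * P.real (N 0 lo₀ hi₀) := by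
        rw [Finset.sum_const, nsmul_eq_mul, ← hcard, Int.cast_natCast]

/-- Monotonicity of the nearest-left event `NL(k; lo, hi)` in the interval `[lo, hi]`. [folklore] -/
private theorem nearestLeft_mono (k : ℤ) {lo hi lo' hi' : ℤ} (hlo : lo' ≤ lo) (hhi : hi ≤ hi') :
    {ω : BondConfig (Site 2) | ∃ t : ℤ, lo ≤ t ∧ t ≤ hi ∧ ω ∈ openConnIn halfPlane (bpt (k)) (bpt t) ∧ ∀ s : ℤ, t < s → s < k → ω ∉ openConnIn halfPlane (bpt (k)) (bpt s)} ⊆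
    {ω : BondConfig (Site 2) | ∃ t : ℤ, lo' ≤ t ∧ t ≤ hi' ∧ ω ∈ openConnIn halfPlane (bpt (k)) (bpt t) ∧ ∀ s : ℤ, t < s → s < k → ω ∉ openConnIn halfPlane (bpt (k)) (bpt s)} := by
  rintro ω ⟨t, h1, h2, h3, h4⟩
  exact ⟨t, hlo.trans h1, h2.trans hhi, h3, h4⟩

/-- STUB Q3' (glue): Q1, Q2 and `Window.stub_windowLowerBound` give Q3 — **`n · P[NL(⌊xn⌋; ⌊an⌋, ⌊bn⌋)] ≥ c₀ > 0`
eventually** (`a < b < x`), by Werner's counting for the nearest-left-neighbour statistic. [folklore] -/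
theorem stub_nearestLeft_lowerBound_of :
    (∀ (ω : BondConfig (Site 2)) (lo hi c' w : ℤ), hi < c' →
      ω ∈ openCrossing halfPlane (rowIcc lo hi) (rowIcc c' w) \ openCrossing halfPlane (rowIcc lo hi) (rowIcc c' 0) →
      ∃ k : ℤ, 1 ≤ k ∧ k ≤ w ∧
        ω ∈ {ω : BondConfig (Site 2) | ∃ t : ℤ, lo ≤ t ∧ t ≤ c' - 1 ∧ ω ∈ openConnIn halfPlane (bpt (k)) (bpt t) ∧ ∀ s : ℤ, t < s → s < k → ω ∉ openConnIn halfPlane (bpt (k)) (bpt s)}) →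
    (∀ (k lo hi : ℤ),
      μ.real {ω : BondConfig (Site 2) | ∃ t : ℤ, lo + k ≤ t ∧ t ≤ hi + k ∧ ω ∈ openConnIn halfPlane (bpt (k)) (bpt t) ∧ ∀ s : ℤ, t < s → s < k → ω ∉ openConnIn halfPlane (bpt (k)) (bpt s)} =
      μ.real {ω : BondConfig (Site 2) | ∃ t : ℤ, lo ≤ t ∧ t ≤ hi ∧ ω ∈ openConnIn halfPlane (bpt (0)) (bpt t) ∧ ∀ s : ℤ, t < s → s < 0 → ω ∉ openConnIn halfPlane (bpt (0)) (bpt s)}) →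
    ∀ (a b x : ℝ), a < b → b < x → ∃ c₀ : ℝ, 0 < c₀ ∧ ∀ᶠ n : ℕ in atTop,
      c₀ ≤ (n : ℝ) * μ.real {ω : BondConfig (Site 2) | ∃ t : ℤ, ⌊a * n⌋ ≤ t ∧ t ≤ ⌊b * n⌋ ∧ ω ∈ openConnIn halfPlane (bpt (⌊x * n⌋)) (bpt t) ∧ ∀ s : ℤ, t < s → s < ⌊x * n⌋ → ω ∉ openConnIn halfPlane (bpt (⌊x * n⌋)) (bpt s)} := by
  intro hQ1 hQ2 a b x hab hbx
  -- the window marks `a' < b' < c'' < 0 < y'`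
  set y' : ℝ := (b - a) / 4 with hy'
  set c'' : ℝ := -(x - b) - (b - a) / 4 with hc''
  set b' : ℝ := -(x - b) - (b - a) / 2 with hb'
  set a' : ℝ := -(x - a) + 3 * (b - a) / 8 with ha'
  have hy'0 : 0 < y' := by rw [hy']; linarith
  have ha'b' : a' < b' := by rw [ha', hb']; linarith
  have hb'c'' : b' < c'' := by rw [hb', hc'']; linarith
  have hc''0 : c'' < 0 := by rw [hc'']; linarith
  have hmargin₁ : y' + a < a' + x := by rw [hy', ha']; linarith
  have hmargin₂ : c'' + x < b + 0 := by rw [hc'']; linarith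
  obtain ⟨c₀, hc₀, hW⟩ := Window.stub_windowLowerBound a' b' c'' 0 y' ha'b' hb'c'' hc''0 hy'0
  refine ⟨c₀ / y', div_pos hc₀ hy'0, ?_⟩
  filter_upwards [hW, Window.eventually_floor_add_two_le hb'c'', Window.eventually_one_le_floor hy'0,
    eventually_floor_add_floor_add_two_le hmargin₁, eventually_floor_add_floor_add_two_le hmargin₂]
    with n hWn e1 e2 e3 e4
  simp only [zero_mul, Int.floor_zero, add_zero] at hWn e4
  -- integer data
  set lo := ⌊a' * (n : ℝ)⌋ with hlo
  set hi := ⌊b' * (n : ℝ)⌋ with hhi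
  set c' := ⌊c'' * (n : ℝ)⌋ with hc'
  set w := ⌊y' * (n : ℝ)⌋ with hw
  set k₀ := ⌊x * (n : ℝ)⌋ with hk₀
  have hwle : (w : ℝ) ≤ y' * n := Int.floor_le _
  -- the counting bound: `P[window] ≤ w · P[NL(0; lo₀, hi₀)]`
  have key : μ.real (openCrossing halfPlane (arcA a' b' n) (rowIcc c' w) \
      openCrossing halfPlane (arcA a' b' n) (rowIcc c' 0)) ≤
      w * μ.real {ω : BondConfig (Site 2) | ∃ t : ℤ, ⌊a * n⌋ - k₀ ≤ t ∧ t ≤ ⌊b * n⌋ - k₀ ∧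
        ω ∈ openConnIn halfPlane (bpt (0)) (bpt t) ∧ ∀ s : ℤ, t < s → s < 0 → ω ∉ openConnIn halfPlane (bpt (0)) (bpt s)} :=
    measureReal_le_mul_of_cover μ
      (fun k lo₁ hi₁ => {ω : BondConfig (Site 2) | ∃ t : ℤ, lo₁ ≤ t ∧ t ≤ hi₁ ∧
        ω ∈ openConnIn halfPlane (bpt (k)) (bpt t) ∧ ∀ s : ℤ, t < s → s < k → ω ∉ openConnIn halfPlane (bpt (k)) (bpt s)})
      _ (lo := lo) (c' := c') (lo₀ := ⌊a * n⌋ - k₀) (hi₀ := ⌊b * n⌋ - k₀)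
      (fun k _ _ _ _ h h' => nearestLeft_mono k h h')
      (fun ω hω => hQ1 ω lo hi c' w (by omega) hω)
      (fun k => hQ2 k (⌊a * n⌋ - k₀) (⌊b * n⌋ - k₀)) (by omega) (by omega) (by omega)
  -- the translate at `k₀ = ⌊xn⌋` is the target event
  have hshift := hQ2 k₀ (⌊a * n⌋ - k₀) (⌊b * n⌋ - k₀)
  simp only [sub_add_cancel] at hshift
  have hfin := hWn.trans (key.trans (mul_le_mul_of_nonneg_right hwle measureReal_nonneg))
  rw [div_le_iff₀ hy'0, hshift]
  exact hfin.trans_eq (mul_rotate _ _ _)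

end Positivity

end Summit.CriticalPhenomena.CardyFormulaZ2.Cruxes.HalfPlaneMarkDensityLaw.SketchLine
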